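import Literature.NumberTheory.Automorphic.HidaLatticeLevelControlTwo
import Literature.NumberTheory.Automorphic.HidaLatticeUpNilpotentInduced
import Literature.NumberTheory.Automorphic.HidaLevelOrdinaryBijection
import Literature.NumberTheory.Automorphic.SymCoeffLatticeFiniteness
import HarnessLib

/-!
# Finite-level control in degree one for the Hida levels and the lattice coefficients; `res` equivariance

Topic `NumberTheory/Automorphic`; namespace `Literature.NumberTheory.Automorphic.BigHeckeGLn.TameLevel`;
theorems only (no named fact, no `sorry`).

`GL₂` over a number field `K`, tame level `U` maximal above `p`, levels `U = U(c,c) ⊴ U' = U(b₁,c)`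
(`e_v c₀ ≤ b₁ ≤ c`, `1 ≤ c`) with the torus sections `d_q` of `HidaLatticeLevelControlTwo`, and the
LATTICE coefficients `τ = ⨂_τ Sym^{k−2}(S²)` on the integral monoid of a family of places above `p`,
`S` a coefficient ring carrying a nilpotent ideal `I` as in `HidaLatticeUpNilpotentInduced` (`S = 𝒪/pⁿ`).
With `T = [· t_{v₀} ·]` (`v₀ ∣ p`) and `M = 2m`:

* `resCohomology_comp_symOp`, `resCohomology_symPolyHom_apply` — `res` between any two Hida levels
  commutes with the symbol operators and with the polynomial action `π` of `O[Syms]` (any coefficients);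
* **`pow_up_apply_eq_zero_of_resCohomology_eq_zero`** (B1) — `res x = 0 ⇒ T^M x = 0` on `H¹(U', τ)`;
* **`pow_up_apply_mem_range_resCohomology`** (B2) — `⟨d_q⟩ ξ = ξ` for all `q` `⇒ T^M ξ ∈ range res`
  on `H¹(U, τ)`;
* `injOn_resCohomology_ordAtΔ_one` — hence `res` is injective on the `U_p`-ordinary part of `H¹(U', τ)`
  (finite cohomology);
* **`exists_mem_ordAtΔ_resCohomology_eq`** — and every `U_p`-ordinary class of `H¹(U, τ)` fixed by the
  `⟨d_q⟩` is `res` of a `U_p`-ordinary class of `H¹(U', τ)` (finite cohomology, commuting `U_{w,1}`).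

[cite: KhareThorne2017, §6.3, Prop. 6.6] [cite: Hida1994AIF, §3, Thm 3.2]

## References

* C. Khare, J. A. Thorne, Amer. J. Math. 139 (2017), §6.2–6.3 (arXiv:1409.7007, held). [KhareThorne2017]
* H. Hida, Ann. Inst. Fourier 44 (1994), §2–3 (held). [Hida1994AIF]
-/

noncomputable section

open CategoryTheory IsDedekindDomain MvPolynomial
open scoped NumberField

namespace Literature.NumberTheory.Automorphic

/-- A linear map injective on a finite set that it maps into itself has all its powers surjective on
that set. [folklore] -/
theorem surjOn_pow_of_injOn_of_mapsTo {R M : Type*} [Semiring R] [AddCommMonoid M] [Module R M]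
    (f : Module.End R M) {s : Set M} (hs : s.Finite) (hm : Set.MapsTo f s s) (hi : Set.InjOn f s) (n : ℕ) :
    Set.SurjOn (f ^ n) s s := by
  have hb : Set.BijOn f s s := (hs.injOn_iff_bijOn_of_mapsTo hm).1 hi
  induction n with
  | zero => intro x hx; exact ⟨x, hx, rfl⟩
  | succ n ih =>
    intro x hx
    obtain ⟨y, hy, rfl⟩ := hb.surjOn hx
    obtain ⟨z, hz, rfl⟩ := ih hy
    exact ⟨z, hz, by rw [pow_succ', Module.End.mul_apply]⟩

namespace BigHeckeGLn

namespace TameLevel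

open IntegralWeightGL2 LevelAction ParallelWeight

variable {K : Type} [Field K] [NumberField K] {p : ℕ} [Fact p.Prime] (𝒰 : TameLevel 2 K p)

/-! ### `res` commutes with the symbol operators (any coefficients) -/

section Res

variable {R : Type} [CommRing R] {V : Type} [AddCommGroup V] [Module R V]
  {E : Type} [Field E] {v : (K →+* E) → HeightOneSpectrum (𝓞 K)} (hv : ∀ τ, (p : 𝓞 K) ∈ (v τ).asIdeal)
  (τv : integralMonoid K v →* Module.End R V) (h𝒰 : 𝒰.IsMaximalAbove) {b₁ c₁ b₂ c₂ : ℕ}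
  (hU₁ : (𝒰.level b₁ c₁).toSubmonoid ≤ integralMonoid K v) (hU₂ : (𝒰.level b₂ c₂).toSubmonoid ≤ integralMonoid K v)
  (hle : 𝒰.level b₂ c₂ ≤ 𝒰.level b₁ c₁) (hc₁ : 1 ≤ c₁) (hc₂ : 1 ≤ c₂) (c₀ : ℕ)

include h𝒰 hc₁ hc₂ in
/-- **`res` commutes with every symbol operator** between two Hida levels. [cite: KhareThorne2017, §6.2, Lemma 6.5] -/
theorem resCohomology_comp_symOp (i : ℕ) (a : 𝒰.Syms c₀) :
    (resCohomology (globalEmbedding 2 K) (integralMonoid K v) τv hle i).hom ∘ₗ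
        𝒰.symOp τv hU₁ c₀ (fun _ hg => 𝒰.goodElements_le_integralMonoid v hg) (fun u => diamondPi_mem_integralMonoid' v hv u) i a =
      𝒰.symOp τv hU₂ c₀ (fun _ hg => 𝒰.goodElements_le_integralMonoid v hg) (fun u => diamondPi_mem_integralMonoid' v hv u) i a ∘ₗ
        (resCohomology (globalEmbedding 2 K) (integralMonoid K v) τv hle i).hom := by
  rcases a with ⟨g, hg⟩ | d
  · rw [symOp_inl, symOp_inl]
    exact 𝒰.resCohomology_comp_heckeCohomology_level (Δ := integralMonoid K v) τv h𝒰 hU₁ hU₂ hle hc₁ hc₂ i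
      (𝒰.goodElements_subset_hidaElements hg) _
  · rw [symOp_inr, symOp_inr]
    exact resCohomology_comp_heckeCohomology_of_bijOn (globalEmbedding 2 K) (integralMonoid K v) τv hU₂ hU₁ hle
      (diamondPi_mem_integralMonoid' v hv d.units) (fun _ : Unit => d.torusElement)
      (bijOn_unit_of_normalizing _ fun x hx => 𝒰.diamondPi_conj_mem_level h𝒰 b₂ c₂ d.units hx)
      (bijOn_unit_of_normalizing _ fun x hx => 𝒰.diamondPi_conj_mem_level h𝒰 b₁ c₁ d.units hx) i

variable {O : Type} [CommRing O] (φ : O →+* R)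

include hc₁ hc₂ in
/-- **`res (π(z) y) = π(z) (res y)`**: `res` intertwines the polynomial actions of `O[Syms]`. [cite: KhareThorne2017, §6.5] -/
theorem resCohomology_symPolyHom_apply (i : ℕ) (z : MvPolynomial (𝒰.Syms c₀) O)
    (y : cohomology (globalEmbedding 2 K) (integralMonoid K v) τv (𝒰.level b₁ c₁) i) :
    (resCohomology (globalEmbedding 2 K) (integralMonoid K v) τv hle i).hom
        (𝒰.symPolyHom τv hU₁ c₀ (fun _ hg => 𝒰.goodElements_le_integralMonoid v hg)
          (fun u => diamondPi_mem_integralMonoid' v hv u) φ h𝒰 i z y) =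
      𝒰.symPolyHom τv hU₂ c₀ (fun _ hg => 𝒰.goodElements_le_integralMonoid v hg)
        (fun u => diamondPi_mem_integralMonoid' v hv u) φ h𝒰 i z
        ((resCohomology (globalEmbedding 2 K) (integralMonoid K v) τv hle i).hom y) :=
  PolyAction.map_polyHom_apply_of_comm (φ := φ) (𝒰.symOp_comm τv hU₁ h𝒰 i) (𝒰.symOp_comm τv hU₂ h𝒰 i) _
    (fun a => 𝒰.resCohomology_comp_symOp hv τv h𝒰 hU₁ hU₂ hle hc₁ hc₂ c₀ i a) z y

end Res

/-! ### Degree one: B1 and B2 for the lattice coefficients -/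

section One

variable {S : Type} [CommRing S] {E : Type} [Field E] [CharZero E] (k : ℕ)
  {v : (K →+* E) → HeightOneSpectrum (𝓞 K)} (hv : ∀ τ, (p : 𝓞 K) ∈ (v τ).asIdeal)
  (red : ∀ τ : K →+* E, (v τ).adicCompletionIntegers K →+* S)
  (h𝒰 : 𝒰.IsMaximalAbove) {c₀ b₁ c : ℕ} (hb₁ : ∀ w : PlacesAbove K p, BigHeckeGLn.ordAt w.1 (p : 𝓞 K) * c₀ ≤ b₁)
  (hbc : b₁ ≤ c) (hc : 1 ≤ c) [((𝒰.level c c).subgroupOf (𝒰.level b₁ c)).Normal]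
  {v₀ : HeightOneSpectrum (𝓞 K)} (hv₀ : (p : 𝓞 K) ∈ v₀.asIdeal)
  {N₀ : ℕ} (hN₀ : c ≤ N₀)
  (hredN : ∀ τ (x : (v τ).adicCompletionIntegers K),
    Valued.v (x : (v τ).adicCompletion K) ≤ (WithZero.exp (-(N₀ : ℤ)) : WithZero (Multiplicative ℤ)) → red τ x = 0)
  (I : Ideal S) {m : ℕ} (hI : I ^ m • (⊤ : Submodule S (SymCoeffLattice S E K k)) = ⊥)
  (hϖ : ∀ τ, v τ = v₀ → red τ ⟨_, uniformizerAt_mem_adicCompletionIntegers K (v τ)⟩ ∈ I)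
  (hJ : (Fintype.card (ArithmeticQuotient.doubleCosetQuot (𝒰.level c c) (heckeElement 2 K v₀ 1 ^ 1)) : S) ∈ I)

omit [CharZero E] in
include h𝒰 hv hv₀ hc in
/-- The unipotent family of `t_{v₀}` lies in the integral monoid. [folklore] -/
theorem unipotentFamily_mem_integralMonoid (j : ArithmeticQuotient.doubleCosetQuot (𝒰.level c c) (heckeElement 2 K v₀ 1 ^ 1)) :
    𝒰.unipotentFamily (v := v₀) c 1 j ∈ integralMonoid K v :=
  𝒰.globalUnipotent_mul_heckeElement_mem_integralMonoid h𝒰 hv hv₀ (𝒰.unipotentRep_spec h𝒰 hv₀ hc j.2).1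

include h𝒰 hb₁ hbc hc hv₀ hN₀ hredN hI hϖ hJ in
/-- **B1: `res x = 0 ⇒ [U' t_{v₀} U']^{2m} x = 0` on `H¹(U(b₁,c), τ)`.** [cite: KhareThorne2017, §6.3, Prop. 6.6] -/
theorem pow_up_apply_eq_zero_of_resCohomology_eq_zero
    (x : cohomology (globalEmbedding 2 K) (integralMonoid K v) (symLatticeAction S E K k v red) (𝒰.level b₁ c) 1)
    (hx : (resCohomology (globalEmbedding 2 K) (integralMonoid K v) (symLatticeAction S E K k v red)
      (𝒰.level_antitone hbc le_rfl : 𝒰.level c c ≤ 𝒰.level b₁ c) 1).hom x = 0) :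
    (heckeCohomology (globalEmbedding 2 K) (integralMonoid K v) (symLatticeAction S E K k v red) (𝒰.level b₁ c)
      (𝒰.level_le_integralMonoid_of_forall_mem hv b₁ c) (heckeElement_mem_integralMonoid v v₀ 1) 1 ^ (2 * m)) x = 0 := by
  classical
  haveI : Module.Free S (SymCoeffLattice S E K k) := Module.Free.of_basis (latticeBasis S E K k)
  have hΔ := 𝒰.unipotentFamily_mem_integralMonoid hv h𝒰 hc hv₀
  have ha := 𝒰.isAdaptedFamily_unipotentFamily (v := v₀) h𝒰 hv₀ hc hbc hc hΔ
  have hα : heckeElement 2 K v₀ 1 ^ 1 ∈ integralMonoid K v := by rw [pow_one]; exact heckeElement_mem_integralMonoid v v₀ 1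
  have key := pow_heckeCohomology_apply_eq_zero_of_resCohomology_eq_zero (globalEmbedding 2 K)
    (symLatticeAction S E K k v red) (𝒰.level_le_integralMonoid_of_forall_mem hv c c)
    (𝒰.level_le_integralMonoid_of_forall_mem hv b₁ c) (𝒰.level_antitone hbc le_rfl)
    (QuotientGroup.mk' ((𝒰.level c c).subgroupOf (𝒰.level b₁ c))) (fun u => 𝒰.mk'_eq_one_iff u)
    (𝒰.torusSectionElt (c₀ := c₀) h𝒰 hb₁ hbc hc) (fun q => 𝒰.mk'_torusSectionElt h𝒰 hb₁ hbc hc q) hα ha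
    (𝒰.coe_unipotentFamily_bijOn' (v := v₀) h𝒰 hv₀ (b' := b₁) hc) (zero_add 1) (m := 2 * m)
    (fun y => by
      rw [𝒰.inducedHeckeCohomology_zero_pow_eq_zero_sym k hv red hbc hc (cokerUnitRep S _)
        (𝒰.level_le_integralMonoid_of_forall_mem hv b₁ c) h𝒰 hv₀ hΔ hN₀ hredN I hI hϖ hJ, LinearMap.zero_apply])
    x hx
  rwa [heckeCohomology_congr (globalEmbedding 2 K) (integralMonoid K v) (symLatticeAction S E K k v red) (𝒰.level b₁ c)
    (𝒰.level_le_integralMonoid_of_forall_mem hv b₁ c) hα (heckeElement_mem_integralMonoid v v₀ 1) (pow_one _) 1] at key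

include hc hv₀ hN₀ hredN hI hϖ hJ in
/-- **B2: `⟨d_q⟩ ξ = ξ` for all `q` `⇒ [U t_{v₀} U]^{2m} ξ ∈ range res` on `H¹(U(c,c), τ)`.**
[cite: KhareThorne2017, §6.3, Prop. 6.6] -/
theorem pow_up_apply_mem_range_resCohomology
    (ξ : cohomology (globalEmbedding 2 K) (integralMonoid K v) (symLatticeAction S E K k v red) (𝒰.level c c) 1)
    (hξ : ∀ q, heckeCohomology (globalEmbedding 2 K) (integralMonoid K v) (symLatticeAction S E K k v red) (𝒰.level c c)
      (𝒰.level_le_integralMonoid_of_forall_mem hv c c)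
      (𝒰.level_le_integralMonoid_of_forall_mem hv b₁ c (𝒰.torusSectionElt h𝒰 hb₁ hbc hc q).2) 1 ξ = ξ) :
    (heckeCohomology (globalEmbedding 2 K) (integralMonoid K v) (symLatticeAction S E K k v red) (𝒰.level c c)
      (𝒰.level_le_integralMonoid_of_forall_mem hv c c) (heckeElement_mem_integralMonoid v v₀ 1) 1 ^ (2 * m)) ξ ∈
      LinearMap.range (resCohomology (globalEmbedding 2 K) (integralMonoid K v) (symLatticeAction S E K k v red)
        (𝒰.level_antitone hbc le_rfl : 𝒰.level c c ≤ 𝒰.level b₁ c) 1).hom := by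
  classical
  haveI : Module.Free S (SymCoeffLattice S E K k) := Module.Free.of_basis (latticeBasis S E K k)
  have hΔ := 𝒰.unipotentFamily_mem_integralMonoid hv h𝒰 hc hv₀
  have ha := 𝒰.isAdaptedFamily_unipotentFamily (v := v₀) h𝒰 hv₀ hc hbc hc hΔ
  have hα : heckeElement 2 K v₀ 1 ^ 1 ∈ integralMonoid K v := by rw [pow_one]; exact heckeElement_mem_integralMonoid v v₀ 1
  have key := pow_heckeCohomology_apply_mem_range_resCohomology (globalEmbedding 2 K)
    (symLatticeAction S E K k v red) (𝒰.level_le_integralMonoid_of_forall_mem hv c c)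
    (𝒰.level_le_integralMonoid_of_forall_mem hv b₁ c) (𝒰.level_antitone hbc le_rfl)
    (QuotientGroup.mk' ((𝒰.level c c).subgroupOf (𝒰.level b₁ c))) (fun u => 𝒰.mk'_eq_one_iff u)
    (𝒰.torusSectionElt (c₀ := c₀) h𝒰 hb₁ hbc hc) (fun q => 𝒰.mk'_torusSectionElt h𝒰 hb₁ hbc hc q) hα ha
    (𝒰.coe_unipotentFamily_bijOn (v := v₀) h𝒰 hv₀ hc) (zero_add 1) (n := 2 * m)
    (fun y => by
      rw [𝒰.inducedHeckeCohomology_zero_pow_eq_zero_sym k hv red hbc hc (cokerDiffRep S _)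
        (𝒰.level_le_integralMonoid_of_forall_mem hv b₁ c) h𝒰 hv₀ hΔ hN₀ hredN I hI hϖ hJ, LinearMap.zero_apply])
    ξ hξ
  rwa [heckeCohomology_congr (globalEmbedding 2 K) (integralMonoid K v) (symLatticeAction S E K k v red) (𝒰.level c c)
    (𝒰.level_le_integralMonoid_of_forall_mem hv c c) hα (heckeElement_mem_integralMonoid v v₀ 1) (pow_one _) 1] at key

end One

/-! ### Consequences for the `U_p`-ordinary parts (any coefficients, given B1/B2) -/

section Ord

variable {R : Type} [CommRing R] {V : Type} [AddCommGroup V] [Module R V]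
  {E : Type} [Field E] {v : (K →+* E) → HeightOneSpectrum (𝓞 K)}
  (τ : integralMonoid K v →* Module.End R V) (h𝒰 : 𝒰.IsMaximalAbove) {b₁ c : ℕ} (hbc : b₁ ≤ c) (hc : 1 ≤ c)
  (hU : (𝒰.level c c).toSubmonoid ≤ integralMonoid K v) (hU' : (𝒰.level b₁ c).toSubmonoid ≤ integralMonoid K v)
  (i : ℕ) {v₀ : HeightOneSpectrum (𝓞 K)} (hv₀ : (p : 𝓞 K) ∈ v₀.asIdeal) {M : ℕ}

include hv₀ in
/-- **`res` is injective on the `U_p`-ordinary part of `H^i(U(b₁,c), τ)`** as soon as `res x = 0 ⇒ T_{v₀}^M x = 0`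
(B1) and the cohomology is finite. [cite: KhareThorne2017, §6.3, Prop. 6.6] -/
theorem injOn_resCohomology_ordAtΔ_of
    [Finite (cohomology (globalEmbedding 2 K) (integralMonoid K v) τ (𝒰.level b₁ c) i)]
    (hB1 : ∀ x, (resCohomology (globalEmbedding 2 K) (integralMonoid K v) τ
        (𝒰.level_antitone hbc le_rfl : 𝒰.level c c ≤ 𝒰.level b₁ c) i).hom x = 0 →
      (heckeCohomology (globalEmbedding 2 K) (integralMonoid K v) τ (𝒰.level b₁ c) hU'
        (heckeElement_mem_integralMonoid v v₀ 1) i ^ M) x = 0) :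
    Set.InjOn (resCohomology (globalEmbedding 2 K) (integralMonoid K v) τ
        (𝒰.level_antitone hbc le_rfl : 𝒰.level c c ≤ 𝒰.level b₁ c) i).hom
      (ordAtΔ (globalEmbedding 2 K) (integralMonoid K v) τ
        (fun w : PlacesAbove K p => heckeElement_mem_integralMonoid v w.1 1) hU' i : Set _) := by
  intro x hx x' hx' hxx'
  set T := heckeCohomology (globalEmbedding 2 K) (integralMonoid K v) τ (𝒰.level b₁ c) hU'
    (heckeElement_mem_integralMonoid v v₀ 1) i with hT
  have hsub : x - x' ∈ (⨅ n : ℕ, LinearMap.range (T ^ n) : Submodule R _) := by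
    have hle : ordAtΔ (globalEmbedding 2 K) (integralMonoid K v) τ
        (fun w : PlacesAbove K p => heckeElement_mem_integralMonoid v w.1 1) hU' i ≤ ⨅ n : ℕ, LinearMap.range (T ^ n) :=
      iInf_le (fun w : PlacesAbove K p => ⨅ n : ℕ, LinearMap.range (heckeCohomology (globalEmbedding 2 K)
        (integralMonoid K v) τ (𝒰.level b₁ c) hU' (heckeElement_mem_integralMonoid v w.1 1) i ^ n)) ⟨v₀, hv₀⟩
    exact hle (Submodule.sub_mem _ hx hx')
  have hzero : (T ^ M) (x - x') = 0 := hB1 (x - x') (by rw [map_sub, sub_eq_zero]; exact hxx')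
  have hpow : Set.InjOn (T ^ M) (⨅ n : ℕ, LinearMap.range (T ^ n) : Submodule R _) := by
    rw [Module.End.coe_pow]
    exact ((OrdFinite.bijOn_iInf_range_pow T).iterate _).injOn
  exact sub_eq_zero.1 (hpow hsub (Submodule.zero_mem _) (by rw [hzero, map_zero]))

include h𝒰 hc hv₀ in
/-- **Every `U_p`-ordinary class of `H^i(U(c,c), τ)` fixed by a set `D` of endomorphisms commuting with the
`U_{w,1}` is `res` of a `U_p`-ordinary class of `H^i(U(b₁,c), τ)`**, as soon as `T_{v₀}^M ξ ∈ range res`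
for every `D`-fixed `ξ` (B2) and the cohomology is finite. [cite: KhareThorne2017, §6.3, Prop. 6.6]
[cite: Hida1994AIF, §3, Thm 3.2] -/
theorem exists_mem_ordAtΔ_resCohomology_eq_of
    [Finite (cohomology (globalEmbedding 2 K) (integralMonoid K v) τ (𝒰.level b₁ c) i)]
    [Finite (cohomology (globalEmbedding 2 K) (integralMonoid K v) τ (𝒰.level c c) i)]
    (D : Set (Module.End R (cohomology (globalEmbedding 2 K) (integralMonoid K v) τ (𝒰.level c c) i)))
    (hD : ∀ d ∈ D, ∀ w : PlacesAbove K p, Commute d (heckeCohomology (globalEmbedding 2 K) (integralMonoid K v) τ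
      (𝒰.level c c) hU (heckeElement_mem_integralMonoid v w.1 1) i))
    (hB2 : ∀ ξ, (∀ d ∈ D, d ξ = ξ) →
      (heckeCohomology (globalEmbedding 2 K) (integralMonoid K v) τ (𝒰.level c c) hU
        (heckeElement_mem_integralMonoid v v₀ 1) i ^ M) ξ ∈
      LinearMap.range (resCohomology (globalEmbedding 2 K) (integralMonoid K v) τ
        (𝒰.level_antitone hbc le_rfl : 𝒰.level c c ≤ 𝒰.level b₁ c) i).hom)
    (y : cohomology (globalEmbedding 2 K) (integralMonoid K v) τ (𝒰.level c c) i)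
    (hy : y ∈ ordAtΔ (globalEmbedding 2 K) (integralMonoid K v) τ
        (fun w : PlacesAbove K p => heckeElement_mem_integralMonoid v w.1 1) hU i)
    (hyq : ∀ d ∈ D, d y = y) :
    ∃ x ∈ ordAtΔ (globalEmbedding 2 K) (integralMonoid K v) τ
        (fun w : PlacesAbove K p => heckeElement_mem_integralMonoid v w.1 1) hU' i,
      (resCohomology (globalEmbedding 2 K) (integralMonoid K v) τ
        (𝒰.level_antitone hbc le_rfl : 𝒰.level c c ≤ 𝒰.level b₁ c) i).hom x = y := by
  classical
  have hUp : ∀ w : PlacesAbove K p, heckeElement 2 K w.1 1 ∈ integralMonoid K v :=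
    fun w => heckeElement_mem_integralMonoid v w.1 1
  have hle : 𝒰.level c c ≤ 𝒰.level b₁ c := 𝒰.level_antitone hbc le_rfl
  set res := (resCohomology (globalEmbedding 2 K) (integralMonoid K v) τ hle i).hom with hres
  set TU : PlacesAbove K p → Module.End R (cohomology (globalEmbedding 2 K) (integralMonoid K v) τ (𝒰.level c c) i) :=
    fun w => heckeCohomology (globalEmbedding 2 K) (integralMonoid K v) τ (𝒰.level c c) hU (hUp w) i with hTU
  set TU' : PlacesAbove K p → Module.End R (cohomology (globalEmbedding 2 K) (integralMonoid K v) τ (𝒰.level b₁ c) i) :=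
    fun w => heckeCohomology (globalEmbedding 2 K) (integralMonoid K v) τ (𝒰.level b₁ c) hU' (hUp w) i with hTU'
  have hcU : ∀ w w', Commute (TU w) (TU w') := fun w w' => 𝒰.commute_up_up τ hU hUp h𝒰 i w w'
  have hcU' : ∀ w w', Commute (TU' w) (TU' w') := fun w w' => 𝒰.commute_up_up τ hU' hUp h𝒰 i w w'
  -- the finite set `B` of ordinary `D`-fixed classes at level `U(c,c)`
  set B : Set (cohomology (globalEmbedding 2 K) (integralMonoid K v) τ (𝒰.level c c) i) :=
    {z | z ∈ ordAtΔ (globalEmbedding 2 K) (integralMonoid K v) τ hUp hU i ∧ ∀ d ∈ D, d z = z} with hB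
  have hBfin : B.Finite := Set.toFinite B
  have hyB : y ∈ B := ⟨hy, hyq⟩
  -- every `TU w` maps `B` into `B` and is injective on `B`
  have hmapsU : ∀ w, Set.MapsTo (TU w) B B := fun w z hz => by
    refine ⟨?_, fun d hd => ?_⟩
    · have hz1 := hz.1
      simp only [ordAtΔ, Submodule.mem_iInf] at hz1 ⊢
      intro w'
      exact (Submodule.mem_iInf _).1 (mapsTo_iInf_range_pow_of_comp_eq (hcU w w').eq ((Submodule.mem_iInf _).2 (hz1 w')))
    · rw [← Module.End.mul_apply, (hD d hd w).eq, Module.End.mul_apply, hz.2 d hd]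
  have hinjU : ∀ w, Set.InjOn (TU w) B := fun w => by
    refine (OrdFinite.bijOn_iInf_range_pow (TU w)).injOn.mono fun z hz => ?_
    exact (iInf_le (fun w' : PlacesAbove K p => ⨅ n : ℕ, LinearMap.range (TU w' ^ n)) w) hz.1
  -- Step 1: every `z ∈ B` is `res` of some class (B2 after extracting a `T_{v₀}^M`-th root inside `B`)
  have hstep : ∀ z ∈ B, ∃ x, res x = z := fun z hz => by
    obtain ⟨z₂, hz₂, rfl⟩ := surjOn_pow_of_injOn_of_mapsTo (TU ⟨v₀, hv₀⟩) hBfin (hmapsU _) (hinjU _) M hz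
    obtain ⟨x, hx⟩ := hB2 z₂ hz₂.2
    exact ⟨x, hx⟩
  -- Step 2: the products `P = ∏_w TU w`, `P' = ∏_w TU' w`; `res ∘ P' = P ∘ res`
  set P := (Finset.univ : Finset (PlacesAbove K p)).noncommProd TU (fun w _ w' _ _ => hcU w w') with hP
  set P' := (Finset.univ : Finset (PlacesAbove K p)).noncommProd TU' (fun w _ w' _ _ => hcU' w w') with hP'
  have hresP : res ∘ₗ P' = P ∘ₗ res :=
    comp_noncommProd_eq_of_forall res _ TU' TU _ _ fun w _ =>
      𝒰.resCohomology_comp_heckeCohomology_level (Δ := integralMonoid K v) τ h𝒰 hU' hU hle hc hc i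
        (𝒰.heckeElement_mem_hidaElements (Or.inr w.2) 1) (hUp w)
  have hresPn : ∀ (n : ℕ) x, res ((P' ^ n) x) = (P ^ n) (res x) := fun n => by
    induction n with
    | zero => intro x; rfl
    | succ n ih =>
      intro x
      rw [pow_succ, pow_succ, Module.End.mul_apply, Module.End.mul_apply, ih, ← LinearMap.comp_apply (f := res),
        hresP, LinearMap.comp_apply]
  -- `P` maps `B` into `B`, injectively
  have hmapsP : Set.MapsTo P B B := by
    rw [hP]
    refine Finset.noncommProd_induction _ _ _ (p := fun f : Module.End R _ => Set.MapsTo f B B) (fun f g hf hg => ?_)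
      (fun z hz => hz) (fun w _ => hmapsU w)
    exact fun z hz => hf (hg hz)
  have hordP : (ordAtΔ (globalEmbedding 2 K) (integralMonoid K v) τ hUp hU i : Submodule R _) =
      ⨅ n : ℕ, LinearMap.range (P ^ n) := ordAtΔ_eq_iInf_range_pow_noncommProd hU i hcU
  have hinjP : Set.InjOn P B := by
    refine (OrdFinite.bijOn_iInf_range_pow P).injOn.mono fun z hz => ?_
    have hz1 : z ∈ (ordAtΔ (globalEmbedding 2 K) (integralMonoid K v) τ hUp hU i : Submodule R _) := hz.1
    rw [hordP] at hz1
    exact hz1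
  -- Step 3: `Ord(U') = range P'^L`
  obtain ⟨L, hL⟩ := exists_iInf_range_pow_eq P'
  have hordP' : (ordAtΔ (globalEmbedding 2 K) (integralMonoid K v) τ hUp hU' i : Submodule R _) =
      LinearMap.range (P' ^ L) := by
    rw [ordAtΔ_eq_iInf_range_pow_noncommProd hU' i hcU']
    exact hL L le_rfl
  -- conclusion
  obtain ⟨y₁, hy₁, rfl⟩ := surjOn_pow_of_injOn_of_mapsTo P hBfin hmapsP hinjP L hyB
  obtain ⟨x₁, hx₁⟩ := hstep y₁ hy₁
  refine ⟨(P' ^ L) x₁, ?_, ?_⟩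
  · rw [hordP']
    exact LinearMap.mem_range_self _ _
  · rw [hresPn, hx₁]

end Ord

/-! ### The lattice coefficients: `res` injective on, and onto, the ordinary `Q`-invariants -/

section OneOrd

variable {S : Type} [CommRing S] {E : Type} [Field E] [CharZero E] (k : ℕ)
  {v : (K →+* E) → HeightOneSpectrum (𝓞 K)} (hv : ∀ τ, (p : 𝓞 K) ∈ (v τ).asIdeal)
  (red : ∀ τ : K →+* E, (v τ).adicCompletionIntegers K →+* S)
  (h𝒰 : 𝒰.IsMaximalAbove) {c₀ b₁ c : ℕ} (hb₁ : ∀ w : PlacesAbove K p, BigHeckeGLn.ordAt w.1 (p : 𝓞 K) * c₀ ≤ b₁)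
  (hbc : b₁ ≤ c) (hc : 1 ≤ c) [((𝒰.level c c).subgroupOf (𝒰.level b₁ c)).Normal]
  {v₀ : HeightOneSpectrum (𝓞 K)} (hv₀ : (p : 𝓞 K) ∈ v₀.asIdeal)
  {N₀ : ℕ} (hN₀ : c ≤ N₀)
  (hredN : ∀ τ (x : (v τ).adicCompletionIntegers K),
    Valued.v (x : (v τ).adicCompletion K) ≤ (WithZero.exp (-(N₀ : ℤ)) : WithZero (Multiplicative ℤ)) → red τ x = 0)
  (I : Ideal S) {m : ℕ} (hI : I ^ m • (⊤ : Submodule S (SymCoeffLattice S E K k)) = ⊥)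
  (hϖ : ∀ τ, v τ = v₀ → red τ ⟨_, uniformizerAt_mem_adicCompletionIntegers K (v τ)⟩ ∈ I)
  (hJ : (Fintype.card (ArithmeticQuotient.doubleCosetQuot (𝒰.level c c) (heckeElement 2 K v₀ 1 ^ 1)) : S) ∈ I)

include h𝒰 hb₁ hbc hc hv₀ hN₀ hredN hI hϖ hJ in
/-- **`res : H¹(U(b₁,c), τ) → H¹(U(c,c), τ)` is injective on the `U_p`-ordinary part** for the lattice
coefficients (finite cohomology). [cite: KhareThorne2017, §6.3, Prop. 6.6] -/
theorem injOn_resCohomology_ordAtΔ_one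
    [Finite (cohomology (globalEmbedding 2 K) (integralMonoid K v) (symLatticeAction S E K k v red) (𝒰.level b₁ c) 1)] :
    Set.InjOn (resCohomology (globalEmbedding 2 K) (integralMonoid K v) (symLatticeAction S E K k v red)
        (𝒰.level_antitone hbc le_rfl : 𝒰.level c c ≤ 𝒰.level b₁ c) 1).hom
      (ordAtΔ (globalEmbedding 2 K) (integralMonoid K v) (symLatticeAction S E K k v red)
        (fun w : PlacesAbove K p => heckeElement_mem_integralMonoid v w.1 1)
        (𝒰.level_le_integralMonoid_of_forall_mem hv b₁ c) 1 : Set _) :=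
  𝒰.injOn_resCohomology_ordAtΔ_of (symLatticeAction S E K k v red) hbc
    (𝒰.level_le_integralMonoid_of_forall_mem hv b₁ c) 1 hv₀
    (fun x hx => 𝒰.pow_up_apply_eq_zero_of_resCohomology_eq_zero k hv red h𝒰 hb₁ hbc hc hv₀ hN₀ hredN I hI hϖ hJ x hx)

include hc hv₀ hN₀ hredN hI hϖ hJ in
/-- **Every `U_p`-ordinary class of `H¹(U(c,c), τ)` fixed by the `⟨d_q⟩` is `res` of a `U_p`-ordinary class
of `H¹(U(b₁,c), τ)`** for the lattice coefficients (finite cohomology).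
[cite: KhareThorne2017, §6.3, Prop. 6.6] [cite: Hida1994AIF, §3, Thm 3.2] -/
theorem exists_mem_ordAtΔ_resCohomology_eq
    [Finite (cohomology (globalEmbedding 2 K) (integralMonoid K v) (symLatticeAction S E K k v red) (𝒰.level b₁ c) 1)]
    [Finite (cohomology (globalEmbedding 2 K) (integralMonoid K v) (symLatticeAction S E K k v red) (𝒰.level c c) 1)]
    (y : cohomology (globalEmbedding 2 K) (integralMonoid K v) (symLatticeAction S E K k v red) (𝒰.level c c) 1)
    (hy : y ∈ ordAtΔ (globalEmbedding 2 K) (integralMonoid K v) (symLatticeAction S E K k v red)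
        (fun w : PlacesAbove K p => heckeElement_mem_integralMonoid v w.1 1)
        (𝒰.level_le_integralMonoid_of_forall_mem hv c c) 1)
    (hyq : ∀ q, heckeCohomology (globalEmbedding 2 K) (integralMonoid K v) (symLatticeAction S E K k v red) (𝒰.level c c)
      (𝒰.level_le_integralMonoid_of_forall_mem hv c c)
      (𝒰.level_le_integralMonoid_of_forall_mem hv b₁ c (𝒰.torusSectionElt h𝒰 hb₁ hbc hc q).2) 1 y = y) :
    ∃ x ∈ ordAtΔ (globalEmbedding 2 K) (integralMonoid K v) (symLatticeAction S E K k v red)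
        (fun w : PlacesAbove K p => heckeElement_mem_integralMonoid v w.1 1)
        (𝒰.level_le_integralMonoid_of_forall_mem hv b₁ c) 1,
      (resCohomology (globalEmbedding 2 K) (integralMonoid K v) (symLatticeAction S E K k v red)
        (𝒰.level_antitone hbc le_rfl : 𝒰.level c c ≤ 𝒰.level b₁ c) 1).hom x = y := by
  refine 𝒰.exists_mem_ordAtΔ_resCohomology_eq_of (symLatticeAction S E K k v red) h𝒰 hbc hc
    (𝒰.level_le_integralMonoid_of_forall_mem hv c c) (𝒰.level_le_integralMonoid_of_forall_mem hv b₁ c) 1 hv₀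
    (Set.range fun q => heckeCohomology (globalEmbedding 2 K) (integralMonoid K v) (symLatticeAction S E K k v red)
      (𝒰.level c c) (𝒰.level_le_integralMonoid_of_forall_mem hv c c)
      (𝒰.level_le_integralMonoid_of_forall_mem hv b₁ c (𝒰.torusSectionElt h𝒰 hb₁ hbc hc q).2) 1)
    ?_ (fun ξ hξ => 𝒰.pow_up_apply_mem_range_resCohomology k hv red h𝒰 hb₁ hbc hc hv₀ hN₀ hredN I hI hϖ hJ ξ
      fun q => hξ _ ⟨q, rfl⟩) y hy (fun d ⟨q, hq⟩ => hq ▸ hyq q)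
  rintro d ⟨q, rfl⟩ w
  have h := 𝒰.commute_symOp_up (symLatticeAction S E K k v red) (𝒰.level_le_integralMonoid_of_forall_mem hv c c)
    (c₀ := c₀) (hG := fun _ hg => 𝒰.goodElements_le_integralMonoid v hg)
    (hD := fun u => diamondPi_mem_integralMonoid' v hv u) (fun w : PlacesAbove K p => heckeElement_mem_integralMonoid v w.1 1)
    h𝒰 1 (Sum.inr (𝒰.torusSection h𝒰 hb₁ hbc hc q)) w
  rw [symOp_inr] at h
  exact h

end OneOrd

end TameLevel

end BigHeckeGLn

end Literature.NumberTheory.Automorphic
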